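import Summits.HodgeConjecture.HodgeConjecture.Theorems.Ring2AtlasCMSixfolds
import Literature.AlgebraicGeometry.ComplexMultiplication.PrimitiveCMTypeSimple
import Literature.NumberTheory.ComplexMultiplication.CMTypeDictionary
import Literature.AlgebraicGeometry.Motives.ZarhinHodgeGroupAutC
import Mathlib.NumberTheory.Cyclotomic.PrimitiveRoots
import Mathlib.NumberTheory.Cyclotomic.Gal
import Mathlib.NumberTheory.NumberField.CMField
import Mathlib.NumberTheory.NumberField.InfinitePlace.Embeddings
import Mathlib.RingTheory.RootsOfUnity.Complex
import Mathlib.Algebra.Algebra.Hom.Rat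
import Mathlib.FieldTheory.Galois.Basic
import Mathlib.FieldTheory.Galois.Abelian
import Mathlib.Data.ZMod.QuotientGroup
import HarnessLib

set_option linter.dupNamespace false

/-!
# Ring 2 · atlas-2 — carriers of the `g = 7` non-vacuity witness: the cyclic CM field of degree 14 in `ℚ(ζ₄₃)`

HONEST FRAMING: research route conditional on HC_CM; not a corollary; Q11.4-sentence-2 already refuted in dim ≥ 3.

Cell `pub-hodge-ring2`, seat `pub-hodge-ring2-atlas-2` (generation 48). First half (split for the 400-line
lint) of the non-vacuity proof for the atlas row `g = 7`, simple, of CM-type (`Ring2AtlasCMSixfolds` §2,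
`HodgeSimpleCMSevenfold`); the second half — the CM type, its primitivity and the non-vacuity theorem — is
`Ring2AtlasCMSevenfoldsNonVacuity`. No cyclotomic field has degree `14` (`φ(n) = 14` has no solution), so
the CM field of the witness is the cyclic subfield of degree `14` of `ℚ(ζ₄₃)` — Shimura 1998 §8.4, after
Example (1) [held text `book:shimura1998-abelian-varieties-with-complex-multiplication-modular-functions`,
chunk p0085, verbatim]: «We can similarly treat the case where `F` is cyclic over `Q`.»

Contents (namespace `Cyclotomic43`; Mathlib carriers; every statement proved outright, no hypothesis):
* `L43 := CyclotomicField 43 ℚ`: `[L43 : ℚ] = 42` (`finrank_L43`), Galois over `ℚ`; `ζ := zeta 43`,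
  `μ := e^{2πi/43} ∈ ℂ`, `conj μ = μ⁴²`; complex embeddings of `ℚ(ζ₄₃)` ↔ exponents prime to `43`
  (`exists_apply_ζ_eq`, `exists_embedding_apply_ζ_eq` via `IsPrimitiveRoot.embeddingsEquivPrimitiveRoots`,
  `ringHom_ext_ζ` via the power basis); `Aut(ℂ)` is transitive on them (`exists_ringEquiv_comp_eq`, from
  `Motives.ZarhinLie.exists_ringEquiv_complex_comp_eq`).
* `σ : ζ ↦ ζ⁶` (`IsCyclotomicExtension.fromZetaAut`), `σ³ = 1 ≠ σ` (`6³ = 216 ≡ 1 mod 43`), `orderOf σ = 3`;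
  `H := ⟨σ⟩`, `|H| = 3`; elements of `H` send `ζ ↦ ζ^(6^j)`, `j < 3` (`exists_apply_ζ_of_mem_H`).
* `K14 := ℚ(ζ₄₃)^H` (`IntermediateField.fixedField H`): `[ℚ(ζ₄₃) : K] = 3`, `[K : ℚ] = 14` (`finrank_K14`),
  `Gal(ℚ(ζ₄₃)/K) = H` (`fixingSubgroup_K14`, Galois correspondence), `x ∈ K ⟺ σ x = x` (`mem_K14_iff`);
  every complex embedding of `K` extends to `ℚ(ζ₄₃)` (`exists_extension`, `ℂ` algebraically closed) and two
  extensions of one embedding differ by an element of `H`, i.e. have exponents `a`, `a·6^j`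
  (`exists_exponent_of_comp_eq`); `K` is totally complex (complex conjugation `ζ ↦ ζ⁴²` is not in
  `H = {ζ ↦ ζ, ζ⁶, ζ³⁶}`: `core_negOne_notMem_H`, `decide`), abelian over `ℚ` (`IsAbelianGalois.of_algHom`
  along `K ⊂ ℚ(ζ₄₃)`), hence a CM FIELD (`instIsCMFieldK14`, Mathlib's
  `NumberField.IsCMField.of_isAbelianGalois`); its maximal real subfield is the degree-7 field
  `ℚ(ζ₄₃ + ζ₄₃⁻¹)^H` (not needed and not constructed).

WHAT THIS IS NOT: number-field bookkeeping only — no atlas word, cell `def`, KIND or count is touched and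
nothing here mentions abelian varieties or Hodge classes.

References: [Shimura1998] G. Shimura, *Abelian Varieties with Complex Multiplication and Modular Functions*,
Princeton (1998), §8.4 (p. 64); §5.5 (CM fields).
-/


noncomputable section

open Polynomial NumberField

namespace Summit.HodgeConjecture.HodgeConjecture.Ring2.Atlas

open Literature.AlgebraicGeometry Literature.AlgebraicGeometry.Motives
open Literature.AlgebraicGeometry.ComplexMultiplication
open Literature.NumberTheory.ComplexMultiplication
open Literature.NumberTheory.Automorphic (PicardCM.CMAbelianVarietyRealised)
open Literature.AlgebraicGeometry.Milne1999 (IsOfCMType)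

namespace Cyclotomic43

/-- The forty-third cyclotomic field `ℚ(ζ₄₃)` (Mathlib's `CyclotomicField 43 ℚ`); Shimura's Galois
closure `L`. [folklore] -/
abbrev L43 : Type := CyclotomicField 43 ℚ

/-- `ℚ(ζ₄₃)/ℚ` is the 43rd cyclotomic extension (re-registered on the `DivisionRing.toRatAlgebra` path,
as for `Cyclotomic13.K13`). [folklore] -/
instance instIsCyclotomicExtensionL43 : IsCyclotomicExtension {43} ℚ L43 :=
  CyclotomicField.isCyclotomicExtension 43 ℚ

/-- The 43rd cyclotomic polynomial is irreducible over `ℚ`. [folklore] -/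
theorem irreducible_cyclotomic43 : Irreducible (cyclotomic 43 ℚ) :=
  cyclotomic.irreducible_rat (by norm_num)

/-- `ℚ(ζ₄₃)/ℚ` is Galois. [folklore] -/
instance instIsGaloisL43 : IsGalois ℚ L43 := IsCyclotomicExtension.isGalois {43} ℚ L43

/-- `[ℚ(ζ₄₃) : ℚ] = φ(43) = 42`. [folklore] -/
theorem finrank_L43 : Module.finrank ℚ L43 = 42 := by
  rw [IsCyclotomicExtension.finrank (n := 43) L43 irreducible_cyclotomic43,
    Nat.totient_prime (by norm_num : Nat.Prime 43)]

/-- The distinguished primitive 43rd root of unity `ζ ∈ ℚ(ζ₄₃)`. [folklore] -/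
def ζ : L43 := IsCyclotomicExtension.zeta 43 ℚ L43

/-- `ζ` is a primitive 43rd root of unity. [folklore] -/
theorem isPrimitiveRoot_ζ : IsPrimitiveRoot ζ 43 := IsCyclotomicExtension.zeta_spec 43 ℚ L43

/-- `ζ⁴³ = 1`. [folklore] -/
theorem ζ_pow_43 : ζ ^ 43 = 1 := isPrimitiveRoot_ζ.pow_eq_one

/-- Exponents of `ζ` only matter mod `43`. [folklore] -/
theorem ζ_pow_mod (n : ℕ) : ζ ^ n = ζ ^ (n % 43) := by
  conv_lhs => rw [← Nat.div_add_mod n 43]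
  rw [pow_add, pow_mul, ζ_pow_43, one_pow, one_mul]

/-- `μ = e^{2πi/43} ∈ ℂ`. [folklore] -/
def μ : ℂ := Complex.exp (2 * Real.pi * Complex.I / (43 : ℕ))

/-- `μ` is a primitive 43rd root of unity in `ℂ`. [folklore] -/
theorem isPrimitiveRoot_μ : IsPrimitiveRoot μ 43 := Complex.isPrimitiveRoot_exp 43 (by norm_num)

/-- `μ⁴³ = 1`. [folklore] -/
theorem μ_pow_43 : μ ^ 43 = 1 := isPrimitiveRoot_μ.pow_eq_one

/-- Exponents of `μ` only matter mod `43`. [folklore] -/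
theorem μ_pow_mod (n : ℕ) : μ ^ n = μ ^ (n % 43) := by
  conv_lhs => rw [← Nat.div_add_mod n 43]
  rw [pow_add, pow_mul, μ_pow_43, one_pow, one_mul]

/-- `μ^i = μ^j` with `i, j < 43` forces `i = j`. [folklore] -/
theorem μ_pow_inj {i j : ℕ} (hi : i < 43) (hj : j < 43) (h : μ ^ i = μ ^ j) : i = j :=
  isPrimitiveRoot_μ.pow_inj hi hj h

/-- Complex conjugation inverts `μ`: `conj μ = μ⁴²`. [folklore] -/
theorem conj_μ : starRingEnd ℂ μ = μ ^ 42 := by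
  have h1 : ‖μ‖ = 1 := Complex.norm_eq_one_of_pow_eq_one μ_pow_43 (by norm_num)
  rw [← Complex.inv_eq_conj h1]
  have h2 : μ ^ 42 * μ = 1 := by rw [← pow_succ, μ_pow_43]
  exact inv_eq_of_mul_eq_one_left h2

/-- Every complex embedding of `ℚ(ζ₄₃)` sends `ζ` to `μ^a` for a unique `1 ≤ a ≤ 42`. [folklore] -/
theorem exists_apply_ζ_eq (s : L43 →+* ℂ) : ∃ a : ℕ, 0 < a ∧ a < 43 ∧ s ζ = μ ^ a := by
  have h1 : (s ζ) ^ 43 = 1 := by rw [← map_pow, ζ_pow_43, map_one]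
  obtain ⟨i, hi, hiζ⟩ := isPrimitiveRoot_μ.eq_pow_of_pow_eq_one h1
  refine ⟨i, Nat.pos_of_ne_zero ?_, hi, hiζ.symm⟩
  rintro rfl
  rw [pow_zero] at hiζ
  have hζ1 : ζ = 1 := s.injective (hiζ.symm.trans (map_one s).symm)
  exact isPrimitiveRoot_ζ.ne_one (by norm_num) hζ1

/-- For every `c` prime to `43` there is a complex embedding `ζ ↦ μ^c`. [folklore] -/
theorem exists_embedding_apply_ζ_eq {c : ℕ} (hc : c.Coprime 43) : ∃ s : L43 →+* ℂ, s ζ = μ ^ c := by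
  have hmem : μ ^ c ∈ primitiveRoots 43 ℂ :=
    (mem_primitiveRoots (by norm_num)).2 (isPrimitiveRoot_μ.pow_of_coprime c hc)
  refine ⟨((isPrimitiveRoot_ζ.embeddingsEquivPrimitiveRoots ℂ irreducible_cyclotomic43).symm
    ⟨μ ^ c, hmem⟩).toRingHom, ?_⟩
  have h := isPrimitiveRoot_ζ.embeddingsEquivPrimitiveRoots_apply_coe ℂ irreducible_cyclotomic43
    ((isPrimitiveRoot_ζ.embeddingsEquivPrimitiveRoots ℂ irreducible_cyclotomic43).symm ⟨μ ^ c, hmem⟩)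
  rw [Equiv.apply_symm_apply] at h
  exact h.symm

/-- A complex embedding of `ℚ(ζ₄₃)` is determined by the image of `ζ`. [folklore] -/
theorem ringHom_ext_ζ {s t : L43 →+* ℂ} (h : s ζ = t ζ) : s = t := by
  have key : s.toRatAlgHom = t.toRatAlgHom :=
    (isPrimitiveRoot_ζ.powerBasis ℚ).algHom_ext (by
      simpa [IsPrimitiveRoot.powerBasis_gen, RingHom.toRatAlgHom_apply] using h)
  calc s = (s.toRatAlgHom : L43 →+* ℂ) := (RingHom.toRatAlgHom_toRingHom s).symm
    _ = (t.toRatAlgHom : L43 →+* ℂ) := by rw [key]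
    _ = t := RingHom.toRatAlgHom_toRingHom t

/-- A `ℚ`-automorphism of `ℚ(ζ₄₃)` is determined by the image of `ζ`. [folklore] -/
theorem algEquiv_ext_ζ {f g : L43 ≃ₐ[ℚ] L43} (h : f ζ = g ζ) : f = g := by
  apply AlgEquiv.coe_toAlgHom_injective
  exact (isPrimitiveRoot_ζ.powerBasis ℚ).algHom_ext (by
    simpa [IsPrimitiveRoot.powerBasis_gen] using h)

/-- `Aut(ℂ)` is transitive on the complex embeddings of `ℚ(ζ₄₃)`. [folklore] -/
theorem exists_ringEquiv_comp_eq (s s' : L43 →+* ℂ) : ∃ τ : ℂ ≃+* ℂ, ∀ x, τ (s x) = s' x := by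
  haveI : Countable L43 := Countable.of_equiv _ (Module.finBasis ℚ L43).equivFun.toEquiv.symm
  exact Motives.ZarhinLie.exists_ringEquiv_complex_comp_eq s s'

/-! ### The automorphism `σ : ζ ↦ ζ⁶` of order `3` and the subgroup `H = ⟨σ⟩` -/

/-- `ζ⁶` is again a primitive 43rd root of unity. [folklore] -/
theorem isPrimitiveRoot_ζ6 : IsPrimitiveRoot (ζ ^ 6) 43 :=
  isPrimitiveRoot_ζ.pow_of_coprime 6 (by decide)

/-- The automorphism `σ` of `ℚ(ζ₄₃)` with `σ ζ = ζ⁶` (`6` has order `3` in `(ℤ/43)^×`). [folklore] -/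
def σ : L43 ≃ₐ[ℚ] L43 := IsCyclotomicExtension.fromZetaAut isPrimitiveRoot_ζ6 irreducible_cyclotomic43

/-- `σ ζ = ζ⁶`. [folklore] -/
theorem σ_ζ : σ ζ = ζ ^ 6 := IsCyclotomicExtension.fromZetaAut_spec isPrimitiveRoot_ζ6 irreducible_cyclotomic43

/-- `σⁿ ζ = ζ^(6ⁿ)`. [folklore] -/
theorem σ_pow_ζ (n : ℕ) : (σ ^ n) ζ = ζ ^ (6 ^ n) := by
  induction n with
  | zero => simp
  | succ n ih => rw [pow_succ, AlgEquiv.mul_apply, σ_ζ, map_pow, ih, ← pow_mul, ← pow_succ]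

/-- `σ³ = 1` (`6³ = 216 ≡ 1 mod 43`). [folklore] -/
theorem σ_pow_three : σ ^ 3 = 1 := by
  apply algEquiv_ext_ζ
  rw [σ_pow_ζ, AlgEquiv.one_apply, ζ_pow_mod]
  norm_num

/-- `σ ≠ 1`. [folklore] -/
theorem σ_ne_one : σ ≠ 1 := by
  intro h
  have h6 : ζ ^ 6 = ζ ^ 1 := by rw [pow_one, ← σ_ζ, h, AlgEquiv.one_apply]
  have := isPrimitiveRoot_ζ.pow_inj (by norm_num) (by norm_num) h6
  omega

/-- `σ` has order `3`. [folklore] -/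
theorem orderOf_σ : orderOf σ = 3 :=
  haveI : Fact (Nat.Prime 3) := ⟨Nat.prime_three⟩
  orderOf_eq_prime σ_pow_three σ_ne_one

/-- `H = ⟨σ⟩ ≤ Gal(ℚ(ζ₄₃)/ℚ)`, the subgroup of order `3` (Shimura's `H₁`). [folklore] -/
def H : Subgroup (L43 ≃ₐ[ℚ] L43) := Subgroup.zpowers σ

/-- `|H| = 3`. [folklore] -/
theorem card_H : Nat.card H = 3 := by
  rw [H, Nat.card_zpowers, orderOf_σ]

/-- Elements of `H` send `ζ` to `ζ^(6^j)`, `j < 3`. [folklore] -/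
theorem exists_apply_ζ_of_mem_H {g : L43 ≃ₐ[ℚ] L43} (hg : g ∈ H) : ∃ j : ℕ, j < 3 ∧ g ζ = ζ ^ (6 ^ j) := by
  obtain ⟨k, rfl⟩ := Subgroup.mem_zpowers_iff.mp hg
  have hk : σ ^ k = σ ^ ((k % 3).toNat) := by
    have h1 := zpow_mod_orderOf σ k
    rw [orderOf_σ] at h1
    rw [← h1, ← zpow_natCast, Int.toNat_of_nonneg (Int.emod_nonneg k (by norm_num))]
    norm_cast
  refine ⟨(k % 3).toNat, ?_, ?_⟩
  · have : k % 3 < 3 := Int.emod_lt_of_pos k (by norm_num)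
    omega
  · rw [hk, σ_pow_ζ]


/-! ### The field `K = ℚ(ζ₄₃)^H`, cyclic of degree `14` over `ℚ` -/

/-- **The CM field of the witness**: `K := ℚ(ζ₄₃)^⟨σ⟩`, the fixed field of `H`, i.e. the unique subfield
of degree `14` of `ℚ(ζ₄₃)` (cyclic over `ℚ`). [folklore] -/
def K14 : IntermediateField ℚ L43 := IntermediateField.fixedField H

/-- `[ℚ(ζ₄₃) : K] = |H| = 3`. [folklore] -/
theorem finrank_K14_L43 : Module.finrank K14 L43 = 3 := by
  rw [K14, IntermediateField.finrank_fixedField_eq_card, card_H]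

/-- `[K : ℚ] = 42 / 3 = 14`. [folklore] -/
theorem finrank_K14 : Module.finrank ℚ K14 = 14 := by
  have h := Module.finrank_mul_finrank ℚ K14 L43
  rw [finrank_K14_L43, finrank_L43] at h
  omega

/-- `K` is a number field. [folklore] -/
instance instNumberFieldK14 : NumberField K14 := inferInstance

/-- The automorphisms of `ℚ(ζ₄₃)` fixing `K` pointwise are exactly `H` (Galois correspondence).
[folklore] -/
theorem fixingSubgroup_K14 : IntermediateField.fixingSubgroup K14 = H :=
  IntermediateField.fixingSubgroup_fixedField H

/-- `x ∈ K` iff `σ x = x`. [folklore] -/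
theorem mem_K14_iff (x : L43) : x ∈ K14 ↔ σ x = x := by
  rw [K14, IntermediateField.mem_fixedField_iff]
  constructor
  · intro h
    exact h σ (Subgroup.mem_zpowers σ)
  · intro h g hg
    have hle : H ≤ MulAction.stabilizer (L43 ≃ₐ[ℚ] L43) x := by
      rw [H, Subgroup.zpowers_le, MulAction.mem_stabilizer_iff]
      exact h
    exact hle hg

/-- Every complex embedding of `K` extends to one of `ℚ(ζ₄₃)` (`ℂ` is algebraically closed).
[folklore] -/
theorem exists_extension (φ : K14 →+* ℂ) :
    ∃ Φ : L43 →+* ℂ, Φ.comp (algebraMap K14 L43) = φ := by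
  letI : Algebra K14 ℂ := φ.toAlgebra
  let Φ : L43 →ₐ[K14] ℂ := IsAlgClosed.lift
  exact ⟨Φ.toRingHom, Φ.comp_algebraMap⟩

/-- **Two complex embeddings of `ℚ(ζ₄₃)` that agree on `K` differ by an element of `H`**: if
`Φ ζ = μ^a` then `Φ' ζ = μ^(a·6^j)` for some `j < 3`. (Galois theory: `ℚ(ζ₄₃)/K` is Galois with group
`H`.) [folklore] -/
theorem exists_exponent_of_comp_eq {Φ Φ' : L43 →+* ℂ}
    (h : Φ.comp (algebraMap K14 L43) = Φ'.comp (algebraMap K14 L43)) {a : ℕ} (ha : Φ ζ = μ ^ a) :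
    ∃ j : ℕ, j < 3 ∧ Φ' ζ = μ ^ (a * 6 ^ j) := by
  obtain ⟨g, hg⟩ := NumberField.ComplexEmbedding.exists_comp_symm_eq_of_comp_eq Φ Φ' h
  have hmem : g.symm.restrictScalars ℚ ∈ H := by
    rw [← fixingSubgroup_K14, IntermediateField.mem_fixingSubgroup_iff]
    intro x hx
    exact g.symm.commutes ⟨x, hx⟩
  obtain ⟨j, hj, hjζ⟩ := exists_apply_ζ_of_mem_H hmem
  refine ⟨j, hj, ?_⟩
  rw [← hg, RingHom.comp_apply, pow_mul, ← ha, ← map_pow]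
  exact congrArg Φ hjζ

/-- Residue arithmetic: `-1 ∉ H`, i.e. `42·a ≢ a·6^j (mod 43)` for units `a` and `j < 3`. Decided by
the kernel. [folklore] -/
theorem core_negOne_notMem_H : ∀ a : ℕ, a < 43 → 0 < a → ∀ j : ℕ, j < 3 →
    (42 * a) % 43 ≠ (a * 6 ^ j) % 43 := by
  decide

/-- **`K` is totally complex**: complex conjugation on `ℚ(ζ₄₃)` (`ζ ↦ ζ⁻¹ = ζ⁴²`) does not lie in
`H = {ζ ↦ ζ, ζ⁶, ζ³⁶}`, so no complex embedding of `K` is real. [folklore] -/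
instance instIsTotallyComplexK14 : IsTotallyComplex K14 := by
  refine ⟨fun v ↦ ?_⟩
  rw [← NumberField.InfinitePlace.not_isReal_iff_isComplex, NumberField.InfinitePlace.isReal_iff,
    NumberField.ComplexEmbedding.isReal_iff]
  intro hreal
  obtain ⟨Φ, hΦ⟩ := exists_extension v.embedding
  obtain ⟨a, ha0, ha, hΦa⟩ := exists_apply_ζ_eq Φ
  have hconj : Φ.comp (algebraMap K14 L43) =
      (NumberField.ComplexEmbedding.conjugate Φ).comp (algebraMap K14 L43) := by
    ext x
    have hx := RingHom.congr_fun hΦ x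
    rw [RingHom.comp_apply] at hx
    rw [RingHom.comp_apply, RingHom.comp_apply, NumberField.ComplexEmbedding.conjugate_coe_eq, hx,
      ← NumberField.ComplexEmbedding.conjugate_coe_eq, hreal]
  obtain ⟨j, hj, hjζ⟩ := exists_exponent_of_comp_eq hconj hΦa
  have h42 : NumberField.ComplexEmbedding.conjugate Φ ζ = μ ^ (42 * a) := by
    rw [NumberField.ComplexEmbedding.conjugate_coe_eq, hΦa, map_pow, conj_μ, ← pow_mul]
  have heq : μ ^ ((42 * a) % 43) = μ ^ ((a * 6 ^ j) % 43) := by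
    rw [← μ_pow_mod, ← μ_pow_mod, ← h42, hjζ]
  exact core_negOne_notMem_H a ha ha0 j hj
    (μ_pow_inj (Nat.mod_lt _ (by norm_num)) (Nat.mod_lt _ (by norm_num)) heq)

/-- `K/ℚ` is abelian (a subextension of the cyclotomic, hence abelian, extension `ℚ(ζ₄₃)/ℚ`;
Mathlib's `IsAbelianGalois.of_algHom` along the inclusion `K ⊂ ℚ(ζ₄₃)`), stated for the canonical
`ℚ`-algebra structure `DivisionRing.toRatAlgebra` that `NumberField.IsCMField.of_isAbelianGalois` consumes.
[folklore] -/
instance instIsAbelianGaloisK14 : @IsAbelianGalois ℚ K14 _ _ DivisionRing.toRatAlgebra :=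
  haveI : IsAbelianGalois ℚ L43 := IsCyclotomicExtension.isAbelianGalois {43} ℚ L43
  IsAbelianGalois.of_algHom (K := ℚ) (L := K14) (M := L43) (algebraMap K14 L43).toRatAlgHom

/-- `K/ℚ` is integral (a number field), for the canonical `ℚ`-algebra structure. [folklore] -/
instance instIsIntegralK14 : @Algebra.IsIntegral ℚ K14 _ _ DivisionRing.toRatAlgebra :=
  inferInstance

/-- **`K` is a CM field** (a totally complex abelian number field; Mathlib's
`NumberField.IsCMField.of_isAbelianGalois`). Its maximal real subfield is the degree-7 subfield
`ℚ(ζ₄₃ + ζ₄₃⁻¹)^⟨σ⟩`. [folklore] -/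
instance instIsCMFieldK14 : IsCMField K14 := IsCMField.of_isAbelianGalois K14

end Cyclotomic43

end Summit.HodgeConjecture.HodgeConjecture.Ring2.Atlas

end
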